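import Summits.CriticalPhenomena.PercolationContinuityZ3.Theorems.PercNearOneGluingAdditiveGluingML5Driver
import HarnessLib

/-!
# Crux `PercNearOneGluing.AdditiveGluing` (stmt-CriticalPhenomena-4576), line `tieline`: the conditional induction driver
# `ML5 ⇐ F2 + TL'`, v2 (lead c9 reshape; TL' = the tie law UNDER the induction hypotheses)

Support file (`--supports stmt-CriticalPhenomena-4576`, helper).  No definitions, no named facts, no sorries.

**`ml5_of_F2_TLIH`.**  The landed driver v1 `ml5_of_F2_TL` (…Theorems/PercNearOneGluingAdditiveGluingML5Driver.lean) with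
the tie-law hypothesis TL (`stub_tieLaw_c9`) replaced by the weaker registered form TL' (`stub_tieLawIH_c9`): across a flip of
the weaker relay along the spectator pair `e = s(c, y)`, `d¹·P¹·s_u(w[e↦0]) + d⁰·P⁰·s_u(w[e↦1]) ≥ 0` is required only GIVEN
the one-weight mixture Lemma 4 (ML5, `μ(N)·G_o ≤ μ(N ∩ O_A)·G_max + μ(N ∩ O_Aᶜ)·G_c`) at both endpoint weightings `w[e↦0]`,
`w[e↦1]` and for all 5-tuples (observer, target, two relays, spectator).  In v1's induction on (number of fractional
non-diagonal pairs, number of positive non-diagonal pairs) these two families are exactly the induction hypotheses available in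
the flip branch of step (a), so v1's proof goes through verbatim: `ML5DriverIH.stepA_orientedIH`, `ML5DriverIH.ml5_stepIH`,
`ML5DriverIH.ml5_inductionIH` are v1's `ML5Driver.stepA_oriented`, `ML5Driver.ml5_step`, `ML5Driver.ml5_induction` with TL'
threaded (the two ML5 families are handed to TL' from the induction hypothesis); the algebra (`ML5Driver.noflip_alg`,
`ML5Driver.flip_alg`), `δ ≥ 0` (`ML5Driver.delta_nonneg`, from F1 `stub_spectatorEdgeBHK_c9`), the elimination of a weight-one
pair (`ML5Driver.elim_sure_pair`, from `stub_mergeTransfer_c9`), the transport (`ML5Driver.ml5_transport`), the base case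
(`stub_ml5Base_c9`) and the one-bond decomposition (`stub_oneBondDecomp_k15`) are reused from the landed files by name.
Once F2 (`stub_spectatorMonotone_c9`) and TL' land: `stub_ml5_c9 := ml5_of_F2_TLIH stub_spectatorMonotone_c9 stub_tieLawIH_c9`.
[cite: KozmaNitzan2024, Lemma 4 / eq. (8)–(9) (pp. 9–10); proof of Thm. 4 (pp. 13–14): one edge weight at a time]
-/

namespace Summit.CriticalPhenomena.PercolationContinuityZ3.Cruxes.AdditiveGluing.TieLine

open MeasureTheory Set Literature.Probability.LatticeModels Literature.Probability.Percolation
open Summit.CriticalPhenomena.PercolationContinuityZ3.Theorems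
open Summit.CriticalPhenomena.PercolationContinuityZ3.Theorems.ML5Driver

noncomputable section
open Classical

namespace ML5DriverIH

variable {n : ℕ}

section Step

variable (w : Sym2 (Fin n) → unitInterval) (o b u v c : Fin n)

/-- **Induction step (a), oriented** (`u` weaker at `w[e↦0]`), v2: ML5 at `w` from ML5 at `w[e↦0]`, `w[e↦1]` FOR ALL 5-TUPLES
(`e = s(c, y)`, `y ∉ {u, v, c}`, `0 < w(e) < 1`, all other non-diagonal weights `< 1`), given F2 (`stub_spectatorMonotone_c9`) and
TL' (`stub_tieLawIH_c9`, the tie law under the induction hypotheses) as hypotheses.  v1's `ML5Driver.stepA_oriented` with the two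
ML5 families passed on to TL' in the flip branch. [cite: KozmaNitzan2024, Lemma 4 / eq. (8)–(9) (pp. 9–10); proof of Thm. 4 (pp. 13–14)] -/
theorem stepA_orientedIH
    (hF2 : ∀ (n : ℕ) (w : Sym2 (Fin n) → unitInterval) (b u v c y : Fin n), c ≠ y → y ≠ u → y ≠ v →
      ((prodBernoulli (Function.update w s(c, y) 0)).real (openConn u b) ≤ (prodBernoulli (Function.update w s(c, y) 0)).real (openConn v b) ∨
        (prodBernoulli (Function.update w s(c, y) 1)).real (openConn u b) ≤ (prodBernoulli (Function.update w s(c, y) 1)).real (openConn v b)) →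
      ((prodBernoulli (Function.update w s(c, y) 0)).real ((openConn u b)ᶜ ∩ openConn v b) -
          (prodBernoulli (Function.update w s(c, y) 0)).real ((openConn c b)ᶜ ∩ (openConn c u ∪ openConn c v) ∩ (openConn u b ∪ openConn v b))) *
        (prodBernoulli (Function.update w s(c, y) 1)).real ((openConn c u)ᶜ ∩ (openConn c v)ᶜ : Set (BondConfig (Fin n))) ≤
      ((prodBernoulli (Function.update w s(c, y) 1)).real ((openConn u b)ᶜ ∩ openConn v b) -
          (prodBernoulli (Function.update w s(c, y) 1)).real ((openConn c b)ᶜ ∩ (openConn c u ∪ openConn c v) ∩ (openConn u b ∪ openConn v b))) *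
        (prodBernoulli (Function.update w s(c, y) 0)).real ((openConn c u)ᶜ ∩ (openConn c v)ᶜ : Set (BondConfig (Fin n))))
    (hTL : ∀ (n : ℕ) (w : Sym2 (Fin n) → unitInterval) (o b u v c y : Fin n), c ≠ y → y ≠ u → y ≠ v → (Literature.Probability.LatticeModels.prodBernoulli (Function.update w s(c, y) 0)).real (Literature.Probability.Percolation.openConn u b) ≤ (Literature.Probability.LatticeModels.prodBernoulli (Function.update w s(c, y) 0)).real (Literature.Probability.Percolation.openConn v b) → (Literature.Probability.LatticeModels.prodBernoulli (Function.update w s(c, y) 1)).real (Literature.Probability.Percolation.openConn v b) ≤ (Literature.Probability.LatticeModels.prodBernoulli (Function.update w s(c, y) 1)).real (Literature.Probability.Percolation.openConn u b) → let μ := fun (w' : Sym2 (Fin n) → unitInterval) (S : Set (Literature.Probability.Percolation.BondConfig (Fin n))) => (Literature.Probability.LatticeModels.prodBernoulli w').real S; let ml5 := fun (w' : Sym2 (Fin n) → unitInterval) (p q i j r : Fin n) => μ w' ((Literature.Probability.Percolation.openConn r i)ᶜ ∩ (Literature.Probability.Percolation.openConn r j)ᶜ) * μ w' ((Literature.Probability.Percolation.openConn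 p q)ᶜ ∩ (Literature.Probability.Percolation.openConn p i ∪ Literature.Probability.Percolation.openConn p j) ∩ (Literature.Probability.Percolation.openConn i q ∪ Literature.Probability.Percolation.openConn j q)) ≤ μ w' ((Literature.Probability.Percolation.openConn r i)ᶜ ∩ (Literature.Probability.Percolation.openConn r j)ᶜ ∩ (Literature.Probability.Percolation.openConn p i ∪ Literature.Probability.Percolation.openConn p j)) * (μ w' (Literature.Probability.Percolation.openConn i q ∪ Literature.Probability.Percolation.openConn j q) - min (μ w' (Literature.Probability.Percolation.openConn i q)) (μ w' (Literature.Probability.Percolation.openConn j q))) + μ w' ((Literature.Probability.Percolation.openConn r i)ᶜ ∩ (Literature.Probability.Percolation.openConn r j)ᶜ ∩ (Literature.Probability.Percolation.openConn p i ∪ Literature.Probability.Percolation.openConn p j)ᶜ) * μ w' ((Literature.Probability.Percolation.openConn r q)ᶜ ∩ (Literature.Probability.Percolation.openConn r i ∪ Literature.Probability.Percolation.openConn r j) ∩ (Literature.Probability.Percolation.openConn i q ∪ Literature.Probability.Percolation.openConn j q)); let N : Set (Literature.Probability.Percolation.BondConfig (Fin n)) := (Literature.Probability.Percolation.openConn c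 u)ᶜ ∩ (Literature.Probability.Percolation.openConn c v)ᶜ; let OA : Set (Literature.Probability.Percolation.BondConfig (Fin n)) := Literature.Probability.Percolation.openConn o u ∪ Literature.Probability.Percolation.openConn o v; let Go : Set (Literature.Probability.Percolation.BondConfig (Fin n)) := (Literature.Probability.Percolation.openConn o b)ᶜ ∩ (Literature.Probability.Percolation.openConn o u ∪ Literature.Probability.Percolation.openConn o v) ∩ (Literature.Probability.Percolation.openConn u b ∪ Literature.Probability.Percolation.openConn v b); let Gc : Set (Literature.Probability.Percolation.BondConfig (Fin n)) := (Literature.Probability.Percolation.openConn c b)ᶜ ∩ (Literature.Probability.Percolation.openConn c u ∪ Literature.Probability.Percolation.openConn c v) ∩ (Literature.Probability.Percolation.openConn u b ∪ Literature.Probability.Percolation.openConn v b); let Gu : Set (Literature.Probability.Percolation.BondConfig (Fin n)) := (Literature.Probability.Percolation.openConn u b)ᶜ ∩ Literature.Probability.Percolation.openConn v b; let s := fun (w' : Sym2 (Fin n) → unitInterval) => μ w' (N ∩ OA) * (μ w' Gu - μ w' Go) + μ w' (N ∩ OAᶜ) * (μ w' Gc - μ w' Go); let w0 := Function.update w s(c,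 y) 0; let w1 := Function.update w s(c, y) 1; (∀ (p q i j r : Fin n), ml5 w0 p q i j r) → (∀ (p q i j r : Fin n), ml5 w1 p q i j r) → 0 ≤ (μ w1 (Literature.Probability.Percolation.openConn u b) - μ w1 (Literature.Probability.Percolation.openConn v b)) * μ w1 N * s w0 + (μ w0 (Literature.Probability.Percolation.openConn v b) - μ w0 (Literature.Probability.Percolation.openConn u b)) * μ w0 N * s w1)
    (y : Fin n) (hcy : c ≠ y) (hyu : y ≠ u) (hyv : y ≠ v) (hcu : c ≠ u) (hcv : c ≠ v)
    (hw : ∀ e : Sym2 (Fin n), ¬ e.IsDiag → e ≠ s(c, y) → (w e : ℝ) < 1)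
    (ht0 : 0 < (w s(c, y) : ℝ)) (ht1 : (w s(c, y) : ℝ) < 1)
    (hτ0 : (prodBernoulli (Function.update w s(c, y) 0)).real (openConn u b : Set (BondConfig (Fin n))) ≤ (prodBernoulli (Function.update w s(c, y) 0)).real (openConn v b : Set (BondConfig (Fin n))))
    (ih0all : ∀ (p q i j r : Fin n), (Measure.real (prodBernoulli (Function.update w s(c, y) 0)) ((openConn r i)ᶜ ∩ (openConn r j)ᶜ : Set (BondConfig (Fin n))) * Measure.real (prodBernoulli (Function.update w s(c, y) 0)) ((openConn p q)ᶜ ∩ (openConn p i ∪ openConn p j) ∩ (openConn i q ∪ openConn j q) : Set (BondConfig (Fin n))) ≤ Measure.real (prodBernoulli (Function.update w s(c, y) 0)) (((openConn r i)ᶜ ∩ (openConn r j)ᶜ : Set (BondConfig (Fin n))) ∩ (openConn p i ∪ openConn p j : Set (BondConfig (Fin n)))) * (Measure.real (prodBernoulli (Function.update w s(c, y) 0)) (openConn i q ∪ openConn j q : Set (BondConfig (Fin n))) - min (Measure.real (prodBernoulli (Function.update w s(c, y) 0)) (openConn i q : Set (BondConfig (Fin n)))) (Measure.real (prodBernoulli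 (Function.update w s(c, y) 0)) (openConn j q : Set (BondConfig (Fin n))))) + Measure.real (prodBernoulli (Function.update w s(c, y) 0)) (((openConn r i)ᶜ ∩ (openConn r j)ᶜ : Set (BondConfig (Fin n))) ∩ (openConn p i ∪ openConn p j : Set (BondConfig (Fin n)))ᶜ) * Measure.real (prodBernoulli (Function.update w s(c, y) 0)) ((openConn r q)ᶜ ∩ (openConn r i ∪ openConn r j) ∩ (openConn i q ∪ openConn j q) : Set (BondConfig (Fin n)))))
    (ih1all : ∀ (p q i j r : Fin n), (Measure.real (prodBernoulli (Function.update w s(c, y) 1)) ((openConn r i)ᶜ ∩ (openConn r j)ᶜ : Set (BondConfig (Fin n))) * Measure.real (prodBernoulli (Function.update w s(c, y) 1)) ((openConn p q)ᶜ ∩ (openConn p i ∪ openConn p j) ∩ (openConn i q ∪ openConn j q) : Set (BondConfig (Fin n))) ≤ Measure.real (prodBernoulli (Function.update w s(c, y) 1)) (((openConn r i)ᶜ ∩ (openConn r j)ᶜ : Set (BondConfig (Fin n))) ∩ (openConn p i ∪ openConn p j : Set (BondConfig (Fin n)))) * (Measure.real (prodBernoulli (Function.update w s(c, y) 1)) (openConn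 i q ∪ openConn j q : Set (BondConfig (Fin n))) - min (Measure.real (prodBernoulli (Function.update w s(c, y) 1)) (openConn i q : Set (BondConfig (Fin n)))) (Measure.real (prodBernoulli (Function.update w s(c, y) 1)) (openConn j q : Set (BondConfig (Fin n))))) + Measure.real (prodBernoulli (Function.update w s(c, y) 1)) (((openConn r i)ᶜ ∩ (openConn r j)ᶜ : Set (BondConfig (Fin n))) ∩ (openConn p i ∪ openConn p j : Set (BondConfig (Fin n)))ᶜ) * Measure.real (prodBernoulli (Function.update w s(c, y) 1)) ((openConn r q)ᶜ ∩ (openConn r i ∪ openConn r j) ∩ (openConn i q ∪ openConn j q) : Set (BondConfig (Fin n))))) : (Measure.real (prodBernoulli w) ((openConn c u)ᶜ ∩ (openConn c v)ᶜ : Set (BondConfig (Fin n))) * Measure.real (prodBernoulli w) ((openConn o b)ᶜ ∩ (openConn o u ∪ openConn o v) ∩ (openConn u b ∪ openConn v b) : Set (BondConfig (Fin n))) ≤ Measure.real (prodBernoulli w) (((openConn c u)ᶜ ∩ (openConn c v)ᶜ : Set (BondConfig (Fin n))) ∩ (openConn o u ∪ openConn o v : Set (BondConfig (Fin n)))) *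 (Measure.real (prodBernoulli w) (openConn u b ∪ openConn v b : Set (BondConfig (Fin n))) - min (Measure.real (prodBernoulli w) (openConn u b : Set (BondConfig (Fin n)))) (Measure.real (prodBernoulli w) (openConn v b : Set (BondConfig (Fin n))))) + Measure.real (prodBernoulli w) (((openConn c u)ᶜ ∩ (openConn c v)ᶜ : Set (BondConfig (Fin n))) ∩ (openConn o u ∪ openConn o v : Set (BondConfig (Fin n)))ᶜ) * Measure.real (prodBernoulli w) ((openConn c b)ᶜ ∩ (openConn c u ∪ openConn c v) ∩ (openConn u b ∪ openConn v b) : Set (BondConfig (Fin n)))) := by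
  have ih0 := ih0all o b u v c
  have ih1 := ih1all o b u v c
  have d : ∀ S : Set (BondConfig (Fin n)), (prodBernoulli w).real S =
      (1 - (w s(c, y) : ℝ)) * (prodBernoulli (Function.update w s(c, y) 0)).real S +
        (w s(c, y) : ℝ) * (prodBernoulli (Function.update w s(c, y) 1)).real S :=
    fun S => stub_oneBondDecomp_k15 n w s(c, y) S
  have hP0 : 0 < (prodBernoulli (Function.update w s(c, y) 0)).real ((openConn c u)ᶜ ∩ (openConn c v)ᶜ : Set (BondConfig (Fin n))) :=
    real_N_pos _ hcu hcv hyu hyv fun e hd hne => by rw [Function.update_of_ne hne]; exact hw e hd hne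
  have hP1 : 0 < (prodBernoulli (Function.update w s(c, y) 1)).real ((openConn c u)ᶜ ∩ (openConn c v)ᶜ : Set (BondConfig (Fin n))) :=
    real_N_pos _ hcu hcv hyu hyv fun e hd hne => by rw [Function.update_of_ne hne]; exact hw e hd hne
  have hδ := delta_nonneg w o u v c y hcy ht0 ht1
  have hN0 := real_N_eq (Function.update w s(c, y) 0) o u v c
  have hN1 := real_N_eq (Function.update w s(c, y) 1) o u v c
  have hRu := hF2 n w b u v c y hcy hyu hyv (Or.inl hτ0)
  rw [hN0] at hδ hRu hP0
  rw [hN1] at hδ hRu hP1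
  rcases le_or_gt ((prodBernoulli (Function.update w s(c, y) 1)).real (openConn u b : Set (BondConfig (Fin n))))
      ((prodBernoulli (Function.update w s(c, y) 1)).real (openConn v b : Set (BondConfig (Fin n)))) with hτ1 | hlt1
  · -- no flip: `u` is the weaker relay at both endpoints
    have hs0 := slackU_nonneg_of_ml5 _ o b u v c ih0 hτ0
    have hs1 := slackU_nonneg_of_ml5 _ o b u v c ih1 hτ1
    apply ml5_of_slackU_nonneg w o b u v c
    rw [d (((openConn c u)ᶜ ∩ (openConn c v)ᶜ : Set (BondConfig (Fin n))) ∩ (openConn o u ∪ openConn o v : Set (BondConfig (Fin n)))), d ((openConn u b)ᶜ ∩ openConn v b : Set (BondConfig (Fin n))), d ((openConn o b)ᶜ ∩ (openConn o u ∪ openConn o v) ∩ (openConn u b ∪ openConn v b) : Set (BondConfig (Fin n))), d (((openConn c u)ᶜ ∩ (openConn c v)ᶜ : Set (BondConfig (Fin n))) ∩ (openConn o u ∪ openConn o v : Set (BondConfig (Fin n)))ᶜ), d ((openConn c b)ᶜ ∩ (openConn c u ∪ openConn c v) ∩ (openConn u b ∪ openConn v b) : Set (BondConfig (Fin n)))]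
    exact noflip_alg _ _ _ _ _ _ _ _ _ _ _ ht0.le ht1.le hP0 hP1 hs0 hs1 hδ (by linarith)
  rcases lt_or_ge ((prodBernoulli (Function.update w s(c, y) 0)).real (openConn u b : Set (BondConfig (Fin n))))
      ((prodBernoulli (Function.update w s(c, y) 0)).real (openConn v b : Set (BondConfig (Fin n)))) with hlt0 | hle0
  swap
  · -- no flip: `v` is the weaker relay at both endpoints
    have hs0 := slackV_nonneg_of_ml5 _ o b u v c ih0 hle0
    have hs1 := slackV_nonneg_of_ml5 _ o b u v c ih1 hlt1.le
    have hRv := hF2 n w b v u c y hcy hyv hyu (Or.inl hle0)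
    rw [union_comm (openConn c v) (openConn c u), union_comm (openConn v b) (openConn u b),
      inter_comm (openConn c v)ᶜ (openConn c u)ᶜ, hN0, hN1] at hRv
    apply ml5_of_slackV_nonneg w o b u v c
    rw [d (((openConn c u)ᶜ ∩ (openConn c v)ᶜ : Set (BondConfig (Fin n))) ∩ (openConn o u ∪ openConn o v : Set (BondConfig (Fin n)))), d ((openConn v b)ᶜ ∩ openConn u b : Set (BondConfig (Fin n))), d ((openConn o b)ᶜ ∩ (openConn o u ∪ openConn o v) ∩ (openConn u b ∪ openConn v b) : Set (BondConfig (Fin n))), d (((openConn c u)ᶜ ∩ (openConn c v)ᶜ : Set (BondConfig (Fin n))) ∩ (openConn o u ∪ openConn o v : Set (BondConfig (Fin n)))ᶜ), d ((openConn c b)ᶜ ∩ (openConn c u ∪ openConn c v) ∩ (openConn u b ∪ openConn v b) : Set (BondConfig (Fin n)))]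
    exact noflip_alg _ _ _ _ _ _ _ _ _ _ _ ht0.le ht1.le hP0 hP1 hs0 hs1 hδ (by linarith)
  · -- flip: `u` strictly weaker at `w⁰`, `v` strictly weaker at `w¹`
    have hs0 := slackU_nonneg_of_ml5 _ o b u v c ih0 hτ0
    have hs1 := slackV_nonneg_of_ml5 _ o b u v c ih1 hlt1.le
    have hRv := hF2 n w b v u c y hcy hyv hyu (Or.inr hlt1.le)
    rw [union_comm (openConn c v) (openConn c u), union_comm (openConn v b) (openConn u b),
      inter_comm (openConn c v)ᶜ (openConn c u)ᶜ, hN0, hN1] at hRv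
    have hT := hTL n w o b u v c y hcy hyu hyv hτ0 hlt1.le ih0all ih1all
    dsimp only at hT
    rw [hN0, hN1] at hT
    have hUV0 : (prodBernoulli (Function.update w s(c, y) 0)).real ((openConn u b)ᶜ ∩ openConn v b : Set (BondConfig (Fin n))) - (prodBernoulli (Function.update w s(c, y) 0)).real ((openConn v b)ᶜ ∩ openConn u b : Set (BondConfig (Fin n))) =
        (prodBernoulli (Function.update w s(c, y) 0)).real (openConn v b : Set (BondConfig (Fin n))) - (prodBernoulli (Function.update w s(c, y) 0)).real (openConn u b : Set (BondConfig (Fin n))) :=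
      real_Gu_sub_Gv _ b u v
    have hUV1 : (prodBernoulli (Function.update w s(c, y) 1)).real ((openConn u b)ᶜ ∩ openConn v b : Set (BondConfig (Fin n))) - (prodBernoulli (Function.update w s(c, y) 1)).real ((openConn v b)ᶜ ∩ openConn u b : Set (BondConfig (Fin n))) =
        -((prodBernoulli (Function.update w s(c, y) 1)).real (openConn u b : Set (BondConfig (Fin n))) - (prodBernoulli (Function.update w s(c, y) 1)).real (openConn v b : Set (BondConfig (Fin n)))) := by
      rw [real_Gu_sub_Gv _ b u v]; ring
    rcases flip_alg _ _ _ _ _ _ _ _ _ _ _ _ _ _ _ ht0.le ht1.le hP0 hP1 (sub_pos.2 hlt0) (sub_pos.2 hlt1) hUV0 hUV1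
        hs0 hs1 hT hδ (by linarith) (by linarith) with h | h
    · apply ml5_of_slackU_nonneg w o b u v c
      rw [d (((openConn c u)ᶜ ∩ (openConn c v)ᶜ : Set (BondConfig (Fin n))) ∩ (openConn o u ∪ openConn o v : Set (BondConfig (Fin n)))), d ((openConn u b)ᶜ ∩ openConn v b : Set (BondConfig (Fin n))), d ((openConn o b)ᶜ ∩ (openConn o u ∪ openConn o v) ∩ (openConn u b ∪ openConn v b) : Set (BondConfig (Fin n))), d (((openConn c u)ᶜ ∩ (openConn c v)ᶜ : Set (BondConfig (Fin n))) ∩ (openConn o u ∪ openConn o v : Set (BondConfig (Fin n)))ᶜ), d ((openConn c b)ᶜ ∩ (openConn c u ∪ openConn c v) ∩ (openConn u b ∪ openConn v b) : Set (BondConfig (Fin n)))]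
      exact h
    · apply ml5_of_slackV_nonneg w o b u v c
      rw [d (((openConn c u)ᶜ ∩ (openConn c v)ᶜ : Set (BondConfig (Fin n))) ∩ (openConn o u ∪ openConn o v : Set (BondConfig (Fin n)))), d ((openConn v b)ᶜ ∩ openConn u b : Set (BondConfig (Fin n))), d ((openConn o b)ᶜ ∩ (openConn o u ∪ openConn o v) ∩ (openConn u b ∪ openConn v b) : Set (BondConfig (Fin n))), d (((openConn c u)ᶜ ∩ (openConn c v)ᶜ : Set (BondConfig (Fin n))) ∩ (openConn o u ∪ openConn o v : Set (BondConfig (Fin n)))ᶜ), d ((openConn c b)ᶜ ∩ (openConn c u ∪ openConn c v) ∩ (openConn u b ∪ openConn v b) : Set (BondConfig (Fin n)))]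
      exact h

end Step

/-- **The induction step of the driver, v2** (all cases), given F2, TL', the transfer statement, and ML5 for every weighting of
smaller measure and every 5-tuple; v1's `ML5Driver.ml5_step` with the whole induction hypothesis at `w[e↦0]`, `w[e↦1]` handed to
step (a). [cite: KozmaNitzan2024, Lemma 4 / eq. (8)–(9) (pp. 9–10); proof of Thm. 4 (pp. 13–14)] -/
theorem ml5_stepIH
    (hF2 : ∀ (n : ℕ) (w : Sym2 (Fin n) → unitInterval) (b u v c y : Fin n), c ≠ y → y ≠ u → y ≠ v →
      ((prodBernoulli (Function.update w s(c, y) 0)).real (openConn u b) ≤ (prodBernoulli (Function.update w s(c, y) 0)).real (openConn v b) ∨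
        (prodBernoulli (Function.update w s(c, y) 1)).real (openConn u b) ≤ (prodBernoulli (Function.update w s(c, y) 1)).real (openConn v b)) →
      ((prodBernoulli (Function.update w s(c, y) 0)).real ((openConn u b)ᶜ ∩ openConn v b) -
          (prodBernoulli (Function.update w s(c, y) 0)).real ((openConn c b)ᶜ ∩ (openConn c u ∪ openConn c v) ∩ (openConn u b ∪ openConn v b))) *
        (prodBernoulli (Function.update w s(c, y) 1)).real ((openConn c u)ᶜ ∩ (openConn c v)ᶜ : Set (BondConfig (Fin n))) ≤
      ((prodBernoulli (Function.update w s(c, y) 1)).real ((openConn u b)ᶜ ∩ openConn v b) -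
          (prodBernoulli (Function.update w s(c, y) 1)).real ((openConn c b)ᶜ ∩ (openConn c u ∪ openConn c v) ∩ (openConn u b ∪ openConn v b))) *
        (prodBernoulli (Function.update w s(c, y) 0)).real ((openConn c u)ᶜ ∩ (openConn c v)ᶜ : Set (BondConfig (Fin n))))
    (hTL : ∀ (n : ℕ) (w : Sym2 (Fin n) → unitInterval) (o b u v c y : Fin n), c ≠ y → y ≠ u → y ≠ v → (Literature.Probability.LatticeModels.prodBernoulli (Function.update w s(c, y) 0)).real (Literature.Probability.Percolation.openConn u b) ≤ (Literature.Probability.LatticeModels.prodBernoulli (Function.update w s(c, y) 0)).real (Literature.Probability.Percolation.openConn v b) → (Literature.Probability.LatticeModels.prodBernoulli (Function.update w s(c, y) 1)).real (Literature.Probability.Percolation.openConn v b) ≤ (Literature.Probability.LatticeModels.prodBernoulli (Function.update w s(c, y) 1)).real (Literature.Probability.Percolation.openConn u b) → let μ := fun (w' : Sym2 (Fin n) → unitInterval) (S : Set (Literature.Probability.Percolation.BondConfig (Fin n))) => (Literature.Probability.LatticeModels.prodBernoulli w').real S; let ml5 := fun (w' : Sym2 (Fin n) → unitInterval) (p q i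 j r : Fin n) => μ w' ((Literature.Probability.Percolation.openConn r i)ᶜ ∩ (Literature.Probability.Percolation.openConn r j)ᶜ) * μ w' ((Literature.Probability.Percolation.openConn p q)ᶜ ∩ (Literature.Probability.Percolation.openConn p i ∪ Literature.Probability.Percolation.openConn p j) ∩ (Literature.Probability.Percolation.openConn i q ∪ Literature.Probability.Percolation.openConn j q)) ≤ μ w' ((Literature.Probability.Percolation.openConn r i)ᶜ ∩ (Literature.Probability.Percolation.openConn r j)ᶜ ∩ (Literature.Probability.Percolation.openConn p i ∪ Literature.Probability.Percolation.openConn p j)) * (μ w' (Literature.Probability.Percolation.openConn i q ∪ Literature.Probability.Percolation.openConn j q) - min (μ w' (Literature.Probability.Percolation.openConn i q)) (μ w' (Literature.Probability.Percolation.openConn j q))) + μ w' ((Literature.Probability.Percolation.openConn r i)ᶜ ∩ (Literature.Probability.Percolation.openConn r j)ᶜ ∩ (Literature.Probability.Percolation.openConn p i ∪ Literature.Probability.Percolation.openConn p j)ᶜ) * μ w' ((Literature.Probability.Percolation.openConn r q)ᶜ ∩ (Literature.Probability.Percolation.openConn r i ∪ Literature.Probability.Percolation.openConn r j) ∩ (Literature.Probability.Percolation.openConn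 i q ∪ Literature.Probability.Percolation.openConn j q)); let N : Set (Literature.Probability.Percolation.BondConfig (Fin n)) := (Literature.Probability.Percolation.openConn c u)ᶜ ∩ (Literature.Probability.Percolation.openConn c v)ᶜ; let OA : Set (Literature.Probability.Percolation.BondConfig (Fin n)) := Literature.Probability.Percolation.openConn o u ∪ Literature.Probability.Percolation.openConn o v; let Go : Set (Literature.Probability.Percolation.BondConfig (Fin n)) := (Literature.Probability.Percolation.openConn o b)ᶜ ∩ (Literature.Probability.Percolation.openConn o u ∪ Literature.Probability.Percolation.openConn o v) ∩ (Literature.Probability.Percolation.openConn u b ∪ Literature.Probability.Percolation.openConn v b); let Gc : Set (Literature.Probability.Percolation.BondConfig (Fin n)) := (Literature.Probability.Percolation.openConn c b)ᶜ ∩ (Literature.Probability.Percolation.openConn c u ∪ Literature.Probability.Percolation.openConn c v) ∩ (Literature.Probability.Percolation.openConn u b ∪ Literature.Probability.Percolation.openConn v b); let Gu : Set (Literature.Probability.Percolation.BondConfig (Fin n)) := (Literature.Probability.Percolation.openConn u b)ᶜ ∩ Literature.Probability.Percolation.openConn v b; let s := fun (w' : Sym2 (Fin n) → unitInterval) =>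 μ w' (N ∩ OA) * (μ w' Gu - μ w' Go) + μ w' (N ∩ OAᶜ) * (μ w' Gc - μ w' Go); let w0 := Function.update w s(c, y) 0; let w1 := Function.update w s(c, y) 1; (∀ (p q i j r : Fin n), ml5 w0 p q i j r) → (∀ (p q i j r : Fin n), ml5 w1 p q i j r) → 0 ≤ (μ w1 (Literature.Probability.Percolation.openConn u b) - μ w1 (Literature.Probability.Percolation.openConn v b)) * μ w1 N * s w0 + (μ w0 (Literature.Probability.Percolation.openConn v b) - μ w0 (Literature.Probability.Percolation.openConn u b)) * μ w0 N * s w1)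
    (hMT : ∀ (n : ℕ) (w w' : Sym2 (Fin n) → unitInterval) (c y : Fin n), c ≠ y → w s(c, y) = 1 → w' s(c, y) = 1 →
      (∀ z : Fin n, z ≠ c → z ≠ y → (1 - (w s(c, z) : ℝ)) * (1 - (w s(y, z) : ℝ)) = (1 - (w' s(c, z) : ℝ)) * (1 - (w' s(y, z) : ℝ))) →
      (∀ e : Sym2 (Fin n), c ∉ e → y ∉ e → w e = w' e) →
      ∀ E : Set (BondConfig (Fin n)), (∀ ω ω' : BondConfig (Fin n),
        (∀ x z : Fin n, (openGraph ω).Reachable x z ↔ (openGraph ω').Reachable x z) → (ω ∈ E ↔ ω' ∈ E)) →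
      (prodBernoulli w).real E = (prodBernoulli w').real E)
    (w : Sym2 (Fin n) → unitInterval)
    (IH : ∀ w' : Sym2 (Fin n) → unitInterval, ((Finset.univ.filter fun f : Sym2 (Fin n) => ¬ f.IsDiag ∧ 0 < (w' f : ℝ) ∧ (w' f : ℝ) < 1).card * (Fintype.card (Sym2 (Fin n)) + 1) + (Finset.univ.filter fun f : Sym2 (Fin n) => ¬ f.IsDiag ∧ 0 < (w' f : ℝ)).card) < ((Finset.univ.filter fun f : Sym2 (Fin n) => ¬ f.IsDiag ∧ 0 < (w f : ℝ) ∧ (w f : ℝ) < 1).card * (Fintype.card (Sym2 (Fin n)) + 1) + (Finset.univ.filter fun f : Sym2 (Fin n) => ¬ f.IsDiag ∧ 0 < (w f : ℝ)).card) → ∀ (o b u v c : Fin n), (Measure.real (prodBernoulli w') ((openConn c u)ᶜ ∩ (openConn c v)ᶜ : Set (BondConfig (Fin n))) * Measure.real (prodBernoulli w') ((openConn o b)ᶜ ∩ (openConn o u ∪ openConn o v) ∩ (openConn u b ∪ openConn v b) : Set (BondConfig (Fin n))) ≤ Measure.real (prodBernoulli w') ((openConn c u)ᶜ ∩ (openConn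 c v)ᶜ ∩ (openConn o u ∪ openConn o v) : Set (BondConfig (Fin n))) * (Measure.real (prodBernoulli w') (openConn u b ∪ openConn v b : Set (BondConfig (Fin n))) - min (Measure.real (prodBernoulli w') (openConn u b : Set (BondConfig (Fin n)))) (Measure.real (prodBernoulli w') (openConn v b : Set (BondConfig (Fin n))))) + Measure.real (prodBernoulli w') ((openConn c u)ᶜ ∩ (openConn c v)ᶜ ∩ (openConn o u ∪ openConn o v)ᶜ : Set (BondConfig (Fin n))) * Measure.real (prodBernoulli w') ((openConn c b)ᶜ ∩ (openConn c u ∪ openConn c v) ∩ (openConn u b ∪ openConn v b) : Set (BondConfig (Fin n)))))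
    (o b u v c : Fin n) : (Measure.real (prodBernoulli w) ((openConn c u)ᶜ ∩ (openConn c v)ᶜ : Set (BondConfig (Fin n))) * Measure.real (prodBernoulli w) ((openConn o b)ᶜ ∩ (openConn o u ∪ openConn o v) ∩ (openConn u b ∪ openConn v b) : Set (BondConfig (Fin n))) ≤ Measure.real (prodBernoulli w) ((openConn c u)ᶜ ∩ (openConn c v)ᶜ ∩ (openConn o u ∪ openConn o v) : Set (BondConfig (Fin n))) * (Measure.real (prodBernoulli w) (openConn u b ∪ openConn v b : Set (BondConfig (Fin n))) - min (Measure.real (prodBernoulli w) (openConn u b : Set (BondConfig (Fin n)))) (Measure.real (prodBernoulli w) (openConn v b : Set (BondConfig (Fin n))))) + Measure.real (prodBernoulli w) ((openConn c u)ᶜ ∩ (openConn c v)ᶜ ∩ (openConn o u ∪ openConn o v)ᶜ : Set (BondConfig (Fin n))) * Measure.real (prodBernoulli w) ((openConn c b)ᶜ ∩ (openConn c u ∪ openConn c v) ∩ (openConn u b ∪ openConn v b) : Set (BondConfig (Fin n)))) := by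
  by_cases hsure : ∃ e : Sym2 (Fin n), ¬ e.IsDiag ∧ w e = 1
  · -- (b) a pair of weight one: transfer and contract, then the induction hypothesis for the relabelled tuple
    obtain ⟨e, hd, he⟩ := hsure
    induction e using Sym2.ind with
    | h x y =>
      have hxy : x ≠ y := fun h => hd (Sym2.mk_isDiag_iff.2 h)
      obtain ⟨w'', g, hF, hP, H⟩ := elim_sure_pair hMT w hxy he
      have hlt : ((Finset.univ.filter fun f : Sym2 (Fin n) => ¬ f.IsDiag ∧ 0 < (w'' f : ℝ) ∧ (w'' f : ℝ) < 1).card * (Fintype.card (Sym2 (Fin n)) + 1) + (Finset.univ.filter fun f : Sym2 (Fin n) => ¬ f.IsDiag ∧ 0 < (w'' f : ℝ)).card) < ((Finset.univ.filter fun f : Sym2 (Fin n) => ¬ f.IsDiag ∧ 0 < (w f : ℝ) ∧ (w f : ℝ) < 1).card * (Fintype.card (Sym2 (Fin n)) + 1) + (Finset.univ.filter fun f : Sym2 (Fin n) => ¬ f.IsDiag ∧ 0 < (w f : ℝ)).card) :=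
        measure_lt ((Finset.card_filter_le _ _).trans (by rw [Finset.card_univ])) (Or.inr ⟨hF, hP⟩)
      exact ml5_transport g o b u v c H (IH w'' hlt (g o) (g b) (g u) (g v) (g c))
  push Not at hsure
  have hw1 : ∀ e : Sym2 (Fin n), ¬ e.IsDiag → (w e : ℝ) < 1 := fun e hd =>
    lt_of_le_of_ne (unitInterval.le_one _) (unitInterval.coe_ne_one.2 (hsure e hd))
  by_cases hc : c = u ∨ c = v
  · exact ml5_of_spectator_mem w o b u v c hc
  push Not at hc
  by_cases hfrac : ∃ y : Fin n, y ≠ u ∧ y ≠ v ∧ y ≠ c ∧ 0 < (w s(c, y) : ℝ)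
  · -- (a) a fractional pair at the spectator
    obtain ⟨y, hyu, hyv, hyc, hpos⟩ := hfrac
    have hcyd : ¬ (s(c, y) : Sym2 (Fin n)).IsDiag := by rw [Sym2.mk_isDiag_iff]; exact fun h => hyc h.symm
    have hlt1 : (w s(c, y) : ℝ) < 1 := hw1 _ hcyd
    have hw' : ∀ e : Sym2 (Fin n), ¬ e.IsDiag → e ≠ s(c, y) → (w e : ℝ) < 1 := fun e hd _ => hw1 e hd
    have hΦ0 : ((Finset.univ.filter fun f : Sym2 (Fin n) => ¬ f.IsDiag ∧ 0 < ((Function.update w s(c, y) 0) f : ℝ) ∧ ((Function.update w s(c, y) 0) f : ℝ) < 1).card * (Fintype.card (Sym2 (Fin n)) + 1) + (Finset.univ.filter fun f : Sym2 (Fin n) => ¬ f.IsDiag ∧ 0 < ((Function.update w s(c, y) 0) f : ℝ)).card) < ((Finset.univ.filter fun f : Sym2 (Fin n) => ¬ f.IsDiag ∧ 0 < (w f : ℝ) ∧ (w f : ℝ) < 1).card * (Fintype.card (Sym2 (Fin n)) + 1) + (Finset.univ.filter fun f : Sym2 (Fin n) => ¬ f.IsDiag ∧ 0 < (w f : ℝ)).card)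 := measure_update_lt w _ hcyd hpos hlt1 0 (Or.inl rfl)
    have hΦ1 : ((Finset.univ.filter fun f : Sym2 (Fin n) => ¬ f.IsDiag ∧ 0 < ((Function.update w s(c, y) 1) f : ℝ) ∧ ((Function.update w s(c, y) 1) f : ℝ) < 1).card * (Fintype.card (Sym2 (Fin n)) + 1) + (Finset.univ.filter fun f : Sym2 (Fin n) => ¬ f.IsDiag ∧ 0 < ((Function.update w s(c, y) 1) f : ℝ)).card) < ((Finset.univ.filter fun f : Sym2 (Fin n) => ¬ f.IsDiag ∧ 0 < (w f : ℝ) ∧ (w f : ℝ) < 1).card * (Fintype.card (Sym2 (Fin n)) + 1) + (Finset.univ.filter fun f : Sym2 (Fin n) => ¬ f.IsDiag ∧ 0 < (w f : ℝ)).card) := measure_update_lt w _ hcyd hpos hlt1 1 (Or.inr rfl)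
    rcases le_total ((prodBernoulli (Function.update w s(c, y) 0)).real (openConn u b))
        ((prodBernoulli (Function.update w s(c, y) 0)).real (openConn v b)) with hτ | hτ
    · exact stepA_orientedIH w o b u v c hF2 hTL y (Ne.symm hyc) hyu hyv hc.1 hc.2 hw' hpos hlt1 hτ
        (IH _ hΦ0) (IH _ hΦ1)
    · exact ml5_symm w o b u v c (stepA_orientedIH w o b v u c hF2 hTL y (Ne.symm hyc) hyv hyu hc.2 hc.1 hw' hpos hlt1 hτ
        (IH _ hΦ0) (IH _ hΦ1))
  · -- (c) every positive pair at the spectator goes to a relay: the base case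
    push Not at hfrac
    exact stub_ml5Base_c9 n w o b u v c fun z hzu hzv hzc => weight_eq_zero_of_not_pos (not_lt.2 (hfrac z hzu hzv hzc))

/-- **The induction, v2** on the measure `Φ = F·(K+1) + M` (v1's `ML5Driver.ml5_induction` with TL' threaded).
[cite: KozmaNitzan2024, Lemma 4 / eq. (8)–(9) (pp. 9–10)] -/
theorem ml5_inductionIH
    (hF2 : ∀ (n : ℕ) (w : Sym2 (Fin n) → unitInterval) (b u v c y : Fin n), c ≠ y → y ≠ u → y ≠ v →
      ((prodBernoulli (Function.update w s(c, y) 0)).real (openConn u b) ≤ (prodBernoulli (Function.update w s(c, y) 0)).real (openConn v b) ∨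
        (prodBernoulli (Function.update w s(c, y) 1)).real (openConn u b) ≤ (prodBernoulli (Function.update w s(c, y) 1)).real (openConn v b)) →
      ((prodBernoulli (Function.update w s(c, y) 0)).real ((openConn u b)ᶜ ∩ openConn v b) -
          (prodBernoulli (Function.update w s(c, y) 0)).real ((openConn c b)ᶜ ∩ (openConn c u ∪ openConn c v) ∩ (openConn u b ∪ openConn v b))) *
        (prodBernoulli (Function.update w s(c, y) 1)).real ((openConn c u)ᶜ ∩ (openConn c v)ᶜ : Set (BondConfig (Fin n))) ≤
      ((prodBernoulli (Function.update w s(c, y) 1)).real ((openConn u b)ᶜ ∩ openConn v b) -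
          (prodBernoulli (Function.update w s(c, y) 1)).real ((openConn c b)ᶜ ∩ (openConn c u ∪ openConn c v) ∩ (openConn u b ∪ openConn v b))) *
        (prodBernoulli (Function.update w s(c, y) 0)).real ((openConn c u)ᶜ ∩ (openConn c v)ᶜ : Set (BondConfig (Fin n))))
    (hTL : ∀ (n : ℕ) (w : Sym2 (Fin n) → unitInterval) (o b u v c y : Fin n), c ≠ y → y ≠ u → y ≠ v → (Literature.Probability.LatticeModels.prodBernoulli (Function.update w s(c, y) 0)).real (Literature.Probability.Percolation.openConn u b) ≤ (Literature.Probability.LatticeModels.prodBernoulli (Function.update w s(c, y) 0)).real (Literature.Probability.Percolation.openConn v b) → (Literature.Probability.LatticeModels.prodBernoulli (Function.update w s(c, y) 1)).real (Literature.Probability.Percolation.openConn v b) ≤ (Literature.Probability.LatticeModels.prodBernoulli (Function.update w s(c, y) 1)).real (Literature.Probability.Percolation.openConn u b) → let μ := fun (w' : Sym2 (Fin n) → unitInterval) (S : Set (Literature.Probability.Percolation.BondConfig (Fin n))) => (Literature.Probability.LatticeModels.prodBernoulli w').real S; let ml5 := fun (w' : Sym2 (Fin n) → unitInterval) (p q i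 j r : Fin n) => μ w' ((Literature.Probability.Percolation.openConn r i)ᶜ ∩ (Literature.Probability.Percolation.openConn r j)ᶜ) * μ w' ((Literature.Probability.Percolation.openConn p q)ᶜ ∩ (Literature.Probability.Percolation.openConn p i ∪ Literature.Probability.Percolation.openConn p j) ∩ (Literature.Probability.Percolation.openConn i q ∪ Literature.Probability.Percolation.openConn j q)) ≤ μ w' ((Literature.Probability.Percolation.openConn r i)ᶜ ∩ (Literature.Probability.Percolation.openConn r j)ᶜ ∩ (Literature.Probability.Percolation.openConn p i ∪ Literature.Probability.Percolation.openConn p j)) * (μ w' (Literature.Probability.Percolation.openConn i q ∪ Literature.Probability.Percolation.openConn j q) - min (μ w' (Literature.Probability.Percolation.openConn i q)) (μ w' (Literature.Probability.Percolation.openConn j q))) + μ w' ((Literature.Probability.Percolation.openConn r i)ᶜ ∩ (Literature.Probability.Percolation.openConn r j)ᶜ ∩ (Literature.Probability.Percolation.openConn p i ∪ Literature.Probability.Percolation.openConn p j)ᶜ) * μ w' ((Literature.Probability.Percolation.openConn r q)ᶜ ∩ (Literature.Probability.Percolation.openConn r i ∪ Literature.Probability.Percolation.openConn r j) ∩ (Literature.Probability.Percolation.openConn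 i q ∪ Literature.Probability.Percolation.openConn j q)); let N : Set (Literature.Probability.Percolation.BondConfig (Fin n)) := (Literature.Probability.Percolation.openConn c u)ᶜ ∩ (Literature.Probability.Percolation.openConn c v)ᶜ; let OA : Set (Literature.Probability.Percolation.BondConfig (Fin n)) := Literature.Probability.Percolation.openConn o u ∪ Literature.Probability.Percolation.openConn o v; let Go : Set (Literature.Probability.Percolation.BondConfig (Fin n)) := (Literature.Probability.Percolation.openConn o b)ᶜ ∩ (Literature.Probability.Percolation.openConn o u ∪ Literature.Probability.Percolation.openConn o v) ∩ (Literature.Probability.Percolation.openConn u b ∪ Literature.Probability.Percolation.openConn v b); let Gc : Set (Literature.Probability.Percolation.BondConfig (Fin n)) := (Literature.Probability.Percolation.openConn c b)ᶜ ∩ (Literature.Probability.Percolation.openConn c u ∪ Literature.Probability.Percolation.openConn c v) ∩ (Literature.Probability.Percolation.openConn u b ∪ Literature.Probability.Percolation.openConn v b); let Gu : Set (Literature.Probability.Percolation.BondConfig (Fin n)) := (Literature.Probability.Percolation.openConn u b)ᶜ ∩ Literature.Probability.Percolation.openConn v b; let s := fun (w' : Sym2 (Fin n) → unitInterval) =>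 μ w' (N ∩ OA) * (μ w' Gu - μ w' Go) + μ w' (N ∩ OAᶜ) * (μ w' Gc - μ w' Go); let w0 := Function.update w s(c, y) 0; let w1 := Function.update w s(c, y) 1; (∀ (p q i j r : Fin n), ml5 w0 p q i j r) → (∀ (p q i j r : Fin n), ml5 w1 p q i j r) → 0 ≤ (μ w1 (Literature.Probability.Percolation.openConn u b) - μ w1 (Literature.Probability.Percolation.openConn v b)) * μ w1 N * s w0 + (μ w0 (Literature.Probability.Percolation.openConn v b) - μ w0 (Literature.Probability.Percolation.openConn u b)) * μ w0 N * s w1)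
    (hMT : ∀ (n : ℕ) (w w' : Sym2 (Fin n) → unitInterval) (c y : Fin n), c ≠ y → w s(c, y) = 1 → w' s(c, y) = 1 →
      (∀ z : Fin n, z ≠ c → z ≠ y → (1 - (w s(c, z) : ℝ)) * (1 - (w s(y, z) : ℝ)) = (1 - (w' s(c, z) : ℝ)) * (1 - (w' s(y, z) : ℝ))) →
      (∀ e : Sym2 (Fin n), c ∉ e → y ∉ e → w e = w' e) →
      ∀ E : Set (BondConfig (Fin n)), (∀ ω ω' : BondConfig (Fin n),
        (∀ x z : Fin n, (openGraph ω).Reachable x z ↔ (openGraph ω').Reachable x z) → (ω ∈ E ↔ ω' ∈ E)) →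
      (prodBernoulli w).real E = (prodBernoulli w').real E) :
    ∀ (m : ℕ) (w : Sym2 (Fin n) → unitInterval), ((Finset.univ.filter fun f : Sym2 (Fin n) => ¬ f.IsDiag ∧ 0 < (w f : ℝ) ∧ (w f : ℝ) < 1).card * (Fintype.card (Sym2 (Fin n)) + 1) + (Finset.univ.filter fun f : Sym2 (Fin n) => ¬ f.IsDiag ∧ 0 < (w f : ℝ)).card) < m → ∀ (o b u v c : Fin n), (Measure.real (prodBernoulli w) ((openConn c u)ᶜ ∩ (openConn c v)ᶜ : Set (BondConfig (Fin n))) * Measure.real (prodBernoulli w) ((openConn o b)ᶜ ∩ (openConn o u ∪ openConn o v) ∩ (openConn u b ∪ openConn v b) : Set (BondConfig (Fin n))) ≤ Measure.real (prodBernoulli w) ((openConn c u)ᶜ ∩ (openConn c v)ᶜ ∩ (openConn o u ∪ openConn o v) : Set (BondConfig (Fin n))) * (Measure.real (prodBernoulli w) (openConn u b ∪ openConn v b : Set (BondConfig (Fin n))) - min (Measure.real (prodBernoulli w) (openConn u b : Set (BondConfig (Fin n)))) (Measure.real (prodBernoulli w) (openConn v b : Set (BondConfig (Fin n))))) + Measure.real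 (prodBernoulli w) ((openConn c u)ᶜ ∩ (openConn c v)ᶜ ∩ (openConn o u ∪ openConn o v)ᶜ : Set (BondConfig (Fin n))) * Measure.real (prodBernoulli w) ((openConn c b)ᶜ ∩ (openConn c u ∪ openConn c v) ∩ (openConn u b ∪ openConn v b) : Set (BondConfig (Fin n)))) := by
  intro m
  induction m with
  | zero => intro w hm; exact absurd hm (Nat.not_lt_zero _)
  | succ m ih =>
    intro w hm o b u v c
    exact ml5_stepIH hF2 hTL hMT w (fun w' hlt => ih w' (by omega)) o b u v c

end ML5DriverIH

open ML5DriverIH in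
/-- **Conditional induction driver `ML5 ⇐ F2 + TL'`, v2** (lead c9 reshape): the registered kernel `stub_ml5_c9` (ML5,
`μ(N)·G_o ≤ μ(N ∩ O_A)·G_max + μ(N ∩ O_Aᶜ)·G_c`) follows from the statements of the registered stubs `stub_spectatorMonotone_c9`
(F2) and `stub_tieLawIH_c9` (TL', the tie law given ML5 at both endpoint weightings for all 5-tuples), by induction on (number of
fractional pairs, number of positive pairs) using the landed F1 (`stub_spectatorEdgeBHK_c9`), one-edge identity
(`stub_ml5EdgeIdentity_c9`), base case (`stub_ml5Base_c9`), merge transfer (`stub_mergeTransfer_c9`) and one-bond decomposition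
(`stub_oneBondDecomp_k15`).  Usage: `stub_ml5_c9 := ml5_of_F2_TLIH stub_spectatorMonotone_c9 stub_tieLawIH_c9`.
[cite: KozmaNitzan2024, Lemma 4 / eq. (8)–(9) (pp. 9–10); proof of Thm. 4 (pp. 13–14)] -/
theorem ml5_of_F2_TLIH
    (hF2 : ∀ (n : ℕ) (w : Sym2 (Fin n) → unitInterval) (b u v c y : Fin n), c ≠ y → y ≠ u → y ≠ v → ((Literature.Probability.LatticeModels.prodBernoulli (Function.update w s(c, y) 0)).real (Literature.Probability.Percolation.openConn u b) ≤ (Literature.Probability.LatticeModels.prodBernoulli (Function.update w s(c, y) 0)).real (Literature.Probability.Percolation.openConn v b) ∨ (Literature.Probability.LatticeModels.prodBernoulli (Function.update w s(c, y) 1)).real (Literature.Probability.Percolation.openConn u b) ≤ (Literature.Probability.LatticeModels.prodBernoulli (Function.update w s(c, y) 1)).real (Literature.Probability.Percolation.openConn v b)) → ((Literature.Probability.LatticeModels.prodBernoulli (Function.update w s(c, y) 0)).real ((Literature.Probability.Percolation.openConn u b)ᶜ ∩ Literature.Probability.Percolation.openConn v b) - (Literature.Probability.LatticeModels.prodBernoulli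 (Function.update w s(c, y) 0)).real ((Literature.Probability.Percolation.openConn c b)ᶜ ∩ (Literature.Probability.Percolation.openConn c u ∪ Literature.Probability.Percolation.openConn c v) ∩ (Literature.Probability.Percolation.openConn u b ∪ Literature.Probability.Percolation.openConn v b))) * (Literature.Probability.LatticeModels.prodBernoulli (Function.update w s(c, y) 1)).real ((Literature.Probability.Percolation.openConn c u)ᶜ ∩ (Literature.Probability.Percolation.openConn c v)ᶜ : Set (Literature.Probability.Percolation.BondConfig (Fin n))) ≤ ((Literature.Probability.LatticeModels.prodBernoulli (Function.update w s(c, y) 1)).real ((Literature.Probability.Percolation.openConn u b)ᶜ ∩ Literature.Probability.Percolation.openConn v b) - (Literature.Probability.LatticeModels.prodBernoulli (Function.update w s(c, y) 1)).real ((Literature.Probability.Percolation.openConn c b)ᶜ ∩ (Literature.Probability.Percolation.openConn c u ∪ Literature.Probability.Percolation.openConn c v) ∩ (Literature.Probability.Percolation.openConn u b ∪ Literature.Probability.Percolation.openConn v b))) * (Literature.Probability.LatticeModels.prodBernoulli (Function.update w s(c, y) 0)).real ((Literature.Probability.Percolation.openConn c u)ᶜ ∩ (Literature.Probability.Percolation.openConn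 c v)ᶜ : Set (Literature.Probability.Percolation.BondConfig (Fin n))))
    (hTL : ∀ (n : ℕ) (w : Sym2 (Fin n) → unitInterval) (o b u v c y : Fin n), c ≠ y → y ≠ u → y ≠ v → (Literature.Probability.LatticeModels.prodBernoulli (Function.update w s(c, y) 0)).real (Literature.Probability.Percolation.openConn u b) ≤ (Literature.Probability.LatticeModels.prodBernoulli (Function.update w s(c, y) 0)).real (Literature.Probability.Percolation.openConn v b) → (Literature.Probability.LatticeModels.prodBernoulli (Function.update w s(c, y) 1)).real (Literature.Probability.Percolation.openConn v b) ≤ (Literature.Probability.LatticeModels.prodBernoulli (Function.update w s(c, y) 1)).real (Literature.Probability.Percolation.openConn u b) → let μ := fun (w' : Sym2 (Fin n) → unitInterval) (S : Set (Literature.Probability.Percolation.BondConfig (Fin n))) => (Literature.Probability.LatticeModels.prodBernoulli w').real S; let ml5 := fun (w' : Sym2 (Fin n) → unitInterval) (p q i j r : Fin n) => μ w' ((Literature.Probability.Percolation.openConn r i)ᶜ ∩ (Literature.Probability.Percolation.openConn r j)ᶜ) * μ w' ((Literature.Probability.Percolation.openConn p q)ᶜ ∩ (Literature.Probability.Percolation.openConn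 p i ∪ Literature.Probability.Percolation.openConn p j) ∩ (Literature.Probability.Percolation.openConn i q ∪ Literature.Probability.Percolation.openConn j q)) ≤ μ w' ((Literature.Probability.Percolation.openConn r i)ᶜ ∩ (Literature.Probability.Percolation.openConn r j)ᶜ ∩ (Literature.Probability.Percolation.openConn p i ∪ Literature.Probability.Percolation.openConn p j)) * (μ w' (Literature.Probability.Percolation.openConn i q ∪ Literature.Probability.Percolation.openConn j q) - min (μ w' (Literature.Probability.Percolation.openConn i q)) (μ w' (Literature.Probability.Percolation.openConn j q))) + μ w' ((Literature.Probability.Percolation.openConn r i)ᶜ ∩ (Literature.Probability.Percolation.openConn r j)ᶜ ∩ (Literature.Probability.Percolation.openConn p i ∪ Literature.Probability.Percolation.openConn p j)ᶜ) * μ w' ((Literature.Probability.Percolation.openConn r q)ᶜ ∩ (Literature.Probability.Percolation.openConn r i ∪ Literature.Probability.Percolation.openConn r j) ∩ (Literature.Probability.Percolation.openConn i q ∪ Literature.Probability.Percolation.openConn j q)); let N : Set (Literature.Probability.Percolation.BondConfig (Fin n)) := (Literature.Probability.Percolation.openConn c u)ᶜ ∩ (Literature.Probability.Percolation.openConn c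 v)ᶜ; let OA : Set (Literature.Probability.Percolation.BondConfig (Fin n)) := Literature.Probability.Percolation.openConn o u ∪ Literature.Probability.Percolation.openConn o v; let Go : Set (Literature.Probability.Percolation.BondConfig (Fin n)) := (Literature.Probability.Percolation.openConn o b)ᶜ ∩ (Literature.Probability.Percolation.openConn o u ∪ Literature.Probability.Percolation.openConn o v) ∩ (Literature.Probability.Percolation.openConn u b ∪ Literature.Probability.Percolation.openConn v b); let Gc : Set (Literature.Probability.Percolation.BondConfig (Fin n)) := (Literature.Probability.Percolation.openConn c b)ᶜ ∩ (Literature.Probability.Percolation.openConn c u ∪ Literature.Probability.Percolation.openConn c v) ∩ (Literature.Probability.Percolation.openConn u b ∪ Literature.Probability.Percolation.openConn v b); let Gu : Set (Literature.Probability.Percolation.BondConfig (Fin n)) := (Literature.Probability.Percolation.openConn u b)ᶜ ∩ Literature.Probability.Percolation.openConn v b; let s := fun (w' : Sym2 (Fin n) → unitInterval) => μ w' (N ∩ OA) * (μ w' Gu - μ w' Go) + μ w' (N ∩ OAᶜ) * (μ w' Gc - μ w' Go); let w0 := Function.update w s(c, y) 0; let w1 := Function.update w s(c, y) 1; (∀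 (p q i j r : Fin n), ml5 w0 p q i j r) → (∀ (p q i j r : Fin n), ml5 w1 p q i j r) → 0 ≤ (μ w1 (Literature.Probability.Percolation.openConn u b) - μ w1 (Literature.Probability.Percolation.openConn v b)) * μ w1 N * s w0 + (μ w0 (Literature.Probability.Percolation.openConn v b) - μ w0 (Literature.Probability.Percolation.openConn u b)) * μ w0 N * s w1) :
    ∀ (n : ℕ) (w : Sym2 (Fin n) → unitInterval) (o b a₁ a₂ c : Fin n),
    (prodBernoulli w).real ((openConn c a₁)ᶜ ∩ (openConn c a₂)ᶜ : Set (BondConfig (Fin n))) *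
        (prodBernoulli w).real ((openConn o b)ᶜ ∩ (openConn o a₁ ∪ openConn o a₂) ∩ (openConn a₁ b ∪ openConn a₂ b)) ≤
      (prodBernoulli w).real ((openConn c a₁)ᶜ ∩ (openConn c a₂)ᶜ ∩ (openConn o a₁ ∪ openConn o a₂)) *
          ((prodBernoulli w).real (openConn a₁ b ∪ openConn a₂ b) -
            min ((prodBernoulli w).real (openConn a₁ b)) ((prodBernoulli w).real (openConn a₂ b))) +
        (prodBernoulli w).real ((openConn c a₁)ᶜ ∩ (openConn c a₂)ᶜ ∩ (openConn o a₁ ∪ openConn o a₂)ᶜ) *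
          (prodBernoulli w).real ((openConn c b)ᶜ ∩ (openConn c a₁ ∪ openConn c a₂) ∩ (openConn a₁ b ∪ openConn a₂ b)) := by
  intro n w o b a₁ a₂ c
  exact ml5_inductionIH hF2 hTL stub_mergeTransfer_c9 _ w (Nat.lt_succ_self _) o b a₁ a₂ c

end

end Summit.CriticalPhenomena.PercolationContinuityZ3.Cruxes.AdditiveGluing.TieLine
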